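import Mathlib
import HarnessLib

/-!
# Stub `stub_normTraceDet` for the line `Sketch` of the crux
# `TwoAdicBianchiProModularityLevel` (stmt-Langlands-15110)

An element `M` of finite order of `M₂(ℚ̄₂)` (`M ^ N = 1`, `0 < N`) has `2`-adically integral trace
(`‖tr M‖ ≤ 1`) and unit determinant (`‖det M‖ = 1`).

Proof: `det M` is an `N`-th root of unity (`det (M ^ N) = det M ^ N`), hence of norm `1`; the
roots of the characteristic polynomial of `M` (which splits, `ℚ̄₂` being algebraically closed) lie
in the spectrum of `M`, so their `N`-th powers lie in the spectrum `{1}` of `M ^ N = 1`: they are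
`N`-th roots of unity, of norm `1`, and the trace is their sum, of norm `≤ 1` by the ultrametric
inequality.
-/

noncomputable section

set_option linter.dupNamespace false -- `Summit.Langlands.Langlands` is the mandated namespace (D-0017)

namespace Summit.Langlands.Langlands.Theorems.TwoAdicBianchiProModularityLevel

/-- In a normed field, an `N`-th root of unity (`0 < N`) has norm `1`. [folklore] -/
theorem norm_eq_one_of_pow_eq_one_of_pos {K : Type*} [NormedField K] {x : K} {N : ℕ}
    (hN : 0 < N) (hx : x ^ N = 1) : ‖x‖ = 1 := by
  have h : ‖x‖ ^ N = 1 := by rw [← norm_pow, hx, norm_one]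
  exact (pow_eq_one_iff_of_nonneg (norm_nonneg x) hN.ne').1 h

/-- Ultrametric inequality for a multiset sum: if every member has norm `≤ 1`, so does the sum.
[folklore] -/
theorem norm_multiset_sum_le_one {K : Type*} [SeminormedAddCommGroup K] [IsUltrametricDist K]
    (s : Multiset K) (h : ∀ x ∈ s, ‖x‖ ≤ 1) : ‖s.sum‖ ≤ 1 := by
  induction s using Multiset.induction_on with
  | empty => simp
  | cons a s ih =>
    rw [Multiset.sum_cons]
    exact (IsUltrametricDist.norm_add_le_max _ _).trans
      (max_le (h a (Multiset.mem_cons_self a s)) (ih fun x hx => h x (Multiset.mem_cons_of_mem hx)))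

/-- Spectral mapping for a power equal to one: if `M ^ N = 1` and `r` is a root of the
characteristic polynomial of the square matrix `M` over a field, then `r ^ N = 1` (Mathlib
`Matrix.mem_spectrum_iff_isRoot_charpoly`, `spectrum.pow_mem_pow`, `spectrum.one_eq`).
[folklore] -/
theorem pow_eq_one_of_mem_roots_charpoly {K : Type*} [Field K] {n : Type*} [Fintype n]
    [DecidableEq n] [Nonempty n] {M : Matrix n n K} {N : ℕ} (hM : M ^ N = 1) {r : K}
    (hr : r ∈ M.charpoly.roots) : r ^ N = 1 := by
  have h1 : r ∈ spectrum K M :=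
    Matrix.mem_spectrum_iff_isRoot_charpoly.mpr (Polynomial.isRoot_of_mem_roots hr)
  have h2 : r ^ N ∈ spectrum K (M ^ N) := spectrum.pow_mem_pow M N h1
  rw [hM, spectrum.one_eq] at h2
  exact h2

/-- An element of finite order of `M₂(ℚ̄₂)` has `2`-adically integral trace and unit determinant
(its eigenvalues are roots of unity). [folklore] -/
theorem stub_normTraceDet : ∀ (M : Matrix (Fin 2) (Fin 2) (PadicAlgCl 2)) (N : ℕ), 0 < N →
    M ^ N = 1 → ‖M.trace‖ ≤ 1 ∧ ‖M.det‖ = 1 := by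
  intro M N hN hMN
  refine ⟨?_, ?_⟩
  · rw [Matrix.trace_eq_sum_roots_charpoly]
    exact norm_multiset_sum_le_one _ fun r hr =>
      (norm_eq_one_of_pow_eq_one_of_pos hN (pow_eq_one_of_mem_roots_charpoly hMN hr)).le
  · have h : M.det ^ N = 1 := by rw [← Matrix.det_pow, hMN, Matrix.det_one]
    exact norm_eq_one_of_pow_eq_one_of_pos hN h

end Summit.Langlands.Langlands.Theorems.TwoAdicBianchiProModularityLevel

end
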